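import Literature.Probability.RandomPlanarGeometry.SLEExistence
import HarnessLib

/-!
# The chordal SLE law of a Dobrushin domain through a prescribed uniformizing map

A step of the transposition of [LSW] Thm. 6.1 to `Literature.Probability.RandomPlanarGeometry.IsSLELaw.hullRestriction_eightThirds`
(plan in `ConformalRestrictionProofs`; G. F. Lawler, O. Schramm, W. Werner, *Conformal
restriction: the chordal case*, J. Amer. Math. Soc. **16** (2003), arXiv:math/0209343): the
restriction property compares the SLE_{8/3} law of `(D; a, b)`, the image of the half-plane SLE
under a chordal uniformizing map `φ`, with the SLE_{8/3} law of a hull subdomain `D'`, which is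
the image of the SAME half-plane SLE under the specific uniformizing map `φ ∘ Φ_A⁻¹` of `D'`
(`HullSubdomainPullback`). The tree's existence theorem
`SLEExistence.exists_isSLECurve_of_aemeasurable` produces an SLE random curve through SOME
uniformizing map; here the same construction is run through a PRESCRIBED one:

* `Literature.Probability.RandomPlanarGeometry.exists_isSLECurve_through` — for `κ > 0` with a trace and every
  chordal uniformizing map `φ` of `(D; a, b)` there is an a.e.-measurable `Γ` which is a.s. the
  class of the time-compactified image of the SLE_κ trace under `φ.boundaryExtension`, ending at
  `b`; in particular `IsSLECurve κ D Γ` (`IsSLECurve.of_through`);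
* `Literature.Probability.RandomPlanarGeometry.IsSLELaw.exists_eq_map_through` — with uniqueness in law (`IsSLECurve.map_eq`, hypothesis
  `h₃`), every SLE_κ law of `D` is the law of that `Γ`: `μ = P.map Γ`.

Inputs as in `SLEExistence`: the trace exists (`hasSLETrace_eight`, `hasSLETrace_of_ne_eight`),
is transient (`tendsto_norm_sleTrace_atTop`), the boundary extension is continuous on the closed
half-plane (`JordanDomain.continuousOn_boundaryExtension`), the trace marginals are
a.e.-measurable (`aemeasurable_sleTrace`). Lawler (2005), §6.3.
-/

noncomputable section

open Set Filter Topology MeasureTheory Complex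
open UpperHalfPlane (upperHalfPlaneSet isOpen_upperHalfPlaneSet)
open scoped NNReal unitInterval

namespace Literature.Probability.RandomPlanarGeometry

variable {κ : ℝ≥0} {D : DobrushinDomain} {φ : ConformalEquiv upperHalfPlaneSet D.carrier}

/-- **Chordal SLE_κ in `(D; a, b)` through a prescribed uniformizing map.** If SLE_κ has a
trace, then for every chordal uniformizing map `φ : ℍ → D` there is an a.e.-measurable random
curve class `Γ` which is almost surely the class of the time-compactified image
`s ↦ φ.boundaryExtension (γ (s/(1-s)))`, `1 ↦ b`, of the SLE_κ trace `γ`. This is the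
construction of `SLEExistence.exists_isSLECurve_of_aemeasurable` with `φ` given rather than
chosen (transience `htr`, Carathéodory continuity `hext`, marginal measurability `hmeas`).
Lawler (2005), §6.3. [cite: Lawler2005, §6.3] -/
theorem exists_isSLECurve_through (hκt : HasSLETrace κ) (hκ : 0 < κ)
    (htr : tendsto_norm_sleTrace_atTop) (hext : JordanDomain.continuousOn_boundaryExtension)
    (hmeas : ∀ t : ℝ≥0, AEMeasurable (fun ω ↦ sleTrace κ ω t) Process.preWienerMeasure)
    (hφ : D.IsChordalUniformizing φ) :
    ∃ Γ : (ℝ≥0 → ℝ) → CurveClass ℂ, AEMeasurable Γ Process.preWienerMeasure ∧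
      ∀ᵐ ω ∂Process.preWienerMeasure, Loewner.IsGeneratedByCurve (sleDriving κ ω) (sleTrace κ ω) ∧
        ∃ c : Curve ℂ, Γ ω = CurveClass.mk c ∧
          IsCompactifiedImage φ.boundaryExtension (sleTrace κ ω) (D.pt 1) c := by
  classical
  set Φ : ℂ → ℂ := φ.boundaryExtension with hΦdef
  set b : ℂ := D.pt 1 with hbdef
  have hΦcont : ContinuousOn Φ (closure upperHalfPlaneSet) := hext D.toJordanDomain φ
  have hΦinf : Tendsto Φ (cocompact ℂ ⊓ 𝓟 (closure upperHalfPlaneSet)) (𝓝 b) :=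
    φ.tendsto_boundaryExtension_cocompact hΦcont hφ.2
  set γ : (ℝ≥0 → ℝ) → ℝ≥0 → ℂ := fun ω ↦ sleTrace κ ω with hγdef
  -- a countable dense set of parameters and measurable modifications of the marginals there
  obtain ⟨S, hSc, hSd⟩ := TopologicalSpace.exists_countable_dense I
  haveI : Countable S := hSc.to_subtype
  have hm : ∀ s : S, AEMeasurable (fun ω ↦ γ ω (rayParam s)) Process.preWienerMeasure :=
    fun s ↦ hmeas (rayParam s)
  set g : S → (ℝ≥0 → ℝ) → ℂ := fun s ↦ (hm s).mk _ with hgdef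
  have hgm : ∀ s, Measurable (g s) := fun s ↦ (hm s).measurable_mk
  -- the good event, of full measure
  set G : Set (ℝ≥0 → ℝ) := {ω | Loewner.IsGeneratedByCurve (sleDriving κ ω) (γ ω) ∧
    Tendsto (fun t ↦ ‖γ ω t‖) atTop atTop ∧ ∀ s : S, γ ω (rayParam s) = g s ω} with hGdef
  have hG : ∀ᵐ ω ∂Process.preWienerMeasure, ω ∈ G := by
    have h3 : ∀ᵐ ω ∂Process.preWienerMeasure, ∀ s : S, γ ω (rayParam s) = g s ω :=
      ae_all_iff.2 fun s ↦ (hm s).ae_eq_mk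
    filter_upwards [ae_isGeneratedByCurve_sleTrace hκt, htr hκ, h3] with ω h1 h2 h3
    exact ⟨h1, h2, h3⟩
  obtain ⟨N, hGN, hNm, hN0⟩ := exists_measurable_superset_of_null (ae_iff.1 hG)
  have hgood : ∀ ω, ω ∈ Nᶜ → ω ∈ G := fun ω hω ↦ by
    by_contra hωG
    exact hω (hGN hωG)
  have hae : ∀ᵐ ω ∂Process.preWienerMeasure, ω ∈ Nᶜ := measure_eq_zero_iff_ae_notMem.1 hN0
  -- the curve on the good event
  have hcurve : ∀ ω, ω ∈ Nᶜ → Continuous (nodeValue Φ b (γ ω)) := fun ω hω ↦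
    continuous_nodeValue hΦcont hΦinf (hgood ω hω).1.continuous
      (fun t ↦ sleTrace_mem_closure κ ω t) (tendsto_cocompact_of_tendsto_norm_atTop (hgood ω hω).2.1)
  set f : (Nᶜ : Set (ℝ≥0 → ℝ)) → CurveClass ℂ :=
    fun ω ↦ CurveClass.mk ⟨⟨nodeValue Φ b (γ ω), hcurve ω ω.2⟩⟩ with hfdef
  -- measurability of `f` on the good event
  have hf : Measurable f := by
    refine measurable_curveClassMk (fun ω : (Nᶜ : Set (ℝ≥0 → ℝ)) ↦ hcurve ω ω.2) hSc hSd ?_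
    intro s hs
    by_cases hs1 : (s : ℝ) < 1
    · have hΦr : Continuous ((closure upperHalfPlaneSet).restrict Φ) :=
        continuousOn_iff_continuous_restrict.1 hΦcont
      have hgs : Measurable fun ω : (Nᶜ : Set (ℝ≥0 → ℝ)) ↦
          (⟨γ ω (rayParam s), sleTrace_mem_closure κ ω _⟩ : closure upperHalfPlaneSet) := by
        refine Measurable.subtype_mk ?_
        have heq : (fun ω : (Nᶜ : Set (ℝ≥0 → ℝ)) ↦ γ ω (rayParam s)) =
            fun ω : (Nᶜ : Set (ℝ≥0 → ℝ)) ↦ g ⟨s, hs⟩ ω :=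
          funext fun ω ↦ (hgood ω ω.2).2.2 ⟨s, hs⟩
        rw [heq]
        exact (hgm ⟨s, hs⟩).comp measurable_subtype_coe
      have heq : (fun ω : (Nᶜ : Set (ℝ≥0 → ℝ)) ↦ nodeValue Φ b (γ ω) s) =
          fun ω : (Nᶜ : Set (ℝ≥0 → ℝ)) ↦ (closure upperHalfPlaneSet).restrict Φ
            ⟨γ ω (rayParam s), sleTrace_mem_closure κ ω _⟩ :=
        funext fun ω ↦ nodeValue_of_lt Φ b (γ ω) hs1
      rw [heq]
      exact hΦr.measurable.comp hgs
    · obtain rfl : s = 1 := Subtype.ext (le_antisymm s.2.2 (not_lt.1 hs1))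
      simp only [nodeValue_one]
      exact measurable_const
  -- the random curve
  refine ⟨fun ω ↦ if hω : ω ∈ Nᶜ then f ⟨ω, hω⟩ else CurveClass.mk (Curve.const b), ?_, ?_⟩
  · exact (Measurable.dite hf measurable_const hNm.compl).aemeasurable
  · filter_upwards [hae] with ω hω
    refine ⟨(hgood ω hω).1, ⟨⟨nodeValue Φ b (γ ω), hcurve ω hω⟩⟩, ?_, ?_, ?_⟩
    · simp only [dif_pos hω, hfdef]
    · intro s hs
      exact nodeValue_of_lt Φ b (γ ω) hs
    · exact nodeValue_one Φ b (γ ω)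

/-- The random curve of `exists_isSLECurve_through` is a chordal SLE_κ curve in `(D; a, b)`. [folklore] -/
theorem IsSLECurve.of_through {Γ : (ℝ≥0 → ℝ) → CurveClass ℂ} (hφ : D.IsChordalUniformizing φ)
    (hΓm : AEMeasurable Γ Process.preWienerMeasure)
    (hΓ : ∀ᵐ ω ∂Process.preWienerMeasure, Loewner.IsGeneratedByCurve (sleDriving κ ω) (sleTrace κ ω) ∧
      ∃ c : Curve ℂ, Γ ω = CurveClass.mk c ∧
        IsCompactifiedImage φ.boundaryExtension (sleTrace κ ω) (D.pt 1) c) :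
    IsSLECurve κ D Γ :=
  ⟨hΓm, φ, hφ, hΓ⟩

/-- **The SLE_κ law of `(D; a, b)` through a prescribed uniformizing map.** With uniqueness in
law of chordal SLE (`IsSLECurve.map_eq`, hypothesis `h₃`), every chordal SLE_κ law `μ` of `D`
is the law of the random curve of `exists_isSLECurve_through` built on ANY chordal uniformizing
map `φ` of `D`: `μ = P.map Γ` with `Γ` a.s. the class of the compactified image of the trace
under `φ.boundaryExtension`. Lawler (2005), §6.3. [cite: Lawler2005, §6.3] -/
theorem IsSLELaw.exists_eq_map_through {μ : Measure (CurveClass ℂ)} (h₃ : IsSLECurve.map_eq)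
    (hκt : HasSLETrace κ) (hκ : 0 < κ) (htr : tendsto_norm_sleTrace_atTop)
    (hext : JordanDomain.continuousOn_boundaryExtension)
    (hmeas : ∀ t : ℝ≥0, AEMeasurable (fun ω ↦ sleTrace κ ω t) Process.preWienerMeasure)
    (hμ : IsSLELaw κ D μ) (hφ : D.IsChordalUniformizing φ) :
    ∃ Γ : (ℝ≥0 → ℝ) → CurveClass ℂ, μ = Process.preWienerMeasure.map Γ ∧
      AEMeasurable Γ Process.preWienerMeasure ∧
      ∀ᵐ ω ∂Process.preWienerMeasure, Loewner.IsGeneratedByCurve (sleDriving κ ω) (sleTrace κ ω) ∧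
        ∃ c : Curve ℂ, Γ ω = CurveClass.mk c ∧
          IsCompactifiedImage φ.boundaryExtension (sleTrace κ ω) (D.pt 1) c := by
  obtain ⟨Γ, hΓm, hΓ⟩ := exists_isSLECurve_through hκt hκ htr hext hmeas hφ
  obtain ⟨Γ₀, hΓ₀, rfl⟩ := hμ
  exact ⟨Γ, h₃ hΓ₀ (IsSLECurve.of_through hφ hΓm hΓ), hΓm, hΓ⟩

end Literature.Probability.RandomPlanarGeometry

end
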